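import Mathlib
import HarnessLib

/-!
# Crux `PriceOfContractivity` (stmt-ValiantsHypothesis-10583), line `birth` —
stub `stub_permCounts`

The two weighted permutation sums behind the "arc induction" (Lemma 2 of the cycle-mean
bound): with `Λ := 16 n`, `y_l := Λ ^ l * δ ^ (l + 1)`, `1 ≤ m`, `m + 1 ≤ n`,
`0 ≤ δ ≤ 1 / (240 n ^ 3)`: `∑_{σ ∈ S_{m+1}, σ 0 ≠ last} ∏_{i ≤ σ i} y_{σ i - i} ≤ y_m / 4` and
`∑_{σ ∈ S_{m+1}, σ 0 = last} ∏_{i ≠ 0, i ≤ σ i} y_{σ i - i} ≤ 3 / 2`.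

Proof.  For a permutation `σ` of `Fin N` let `W = {i | i ≤ σ i}` (weak excedances) and
`s σ = ∑_i (i - σ i - 1)` (truncated: the "surplus" of the drops).  Conservation
`∑ σ i = ∑ i` turns the first summand into `y_m * Φ σ`, `Φ σ = Λ (Λδ)^{s σ} / Λ^{#W}`, and the
second (for `σ 0 = last`) into `Φ σ`.  The map `code σ : Fin N → ℕ ⊕ ℕ`, `i ↦ inr (rk σ i)`
on `W`, `i ↦ inl (i - σ i - 1)` on drops, `rk σ i = #{v | i ≤ v < σ i, v ∉ σ '' (i, N)}`, is
injective (reconstruct `σ` from the top), and `∑_{i ∈ W} rk σ i ≤ s σ` (cut identity +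
double counting).  Hence `Φ σ ≤ Ω (code σ)` for the product weight `Ω c = Λ ∏_i κ (c i)`,
`κ (inl u) = (2Λδ)^u`, `κ (inr r) = Λ⁻¹ 2^{-r}`, and summing `Ω` over a box of codes (position
`0` always has code `inr 0`) gives at most
`(∑_u (2Λδ)^u + Λ⁻¹ ∑_r 2^{-r})^m ≤ (1 + 64 n δ + 1/(8 n))^m ≤ 5/4`.  The rotation `i ↦ i - 1`
is the only permutation with code `(inr 0, inl 0, …, inl 0)` (weight `1`) and is excluded from
the first sum: the bounds are `y_m (5/4 - 1) = y_m / 4` and `5/4 ≤ 3/2`.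
-/

-- single-conjunct layout: Sub = Summit, duplicated namespace component intended
set_option linter.dupNamespace false

namespace Summit.ValiantsHypothesis.ValiantsHypothesis.Theorems.PriceOfContractivity.PermCounts

open Finset

/-- `rk(σ, a)`: the rank of position `a` under `σ` — the number of values `v` with
`a ≤ v < σ a` not hit by a position above `a`. -/
local notation3 (prettyPrint := false) "rk(" σ ", " a ")" =>
  (Finset.card (Finset.filter (fun v => a ≤ v ∧ v < σ a ∧ ∀ p, a < p → σ p ≠ v) Finset.univ))

/-- `sur(σ)`: the surplus of `σ` — total length of the drops minus their number. -/
local notation3 (prettyPrint := false) "sur(" σ ")" =>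
  (Finset.sum Finset.univ (fun p => Fin.val p - Fin.val (σ p) - 1))

/-- `code(σ)`: ranks on weak excedances, drop surpluses on drops. -/
local notation3 (prettyPrint := false) "code(" σ ")" => (fun a =>
  if Fin.val a ≤ Fin.val (σ a) then Sum.inr rk(σ, a) else Sum.inl (Fin.val a - Fin.val (σ a) - 1))

variable {N : ℕ}

/-- If `σ, τ` agree above `a` and `a ≤ σ a < τ a` then `rk(σ, a) < rk(τ, a)`. [folklore] -/
theorem rank_lt_rank {σ τ : Equiv.Perm (Fin N)} {a : Fin N} (h : ∀ p, a < p → σ p = τ p)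
    (ha : a ≤ σ a) (hlt : σ a < τ a) : rk(σ, a) < rk(τ, a) := by
  have hsub : (univ.filter fun v : Fin N => a ≤ v ∧ v < σ a ∧ ∀ p, a < p → σ p ≠ v) ⊆
      (univ.filter fun v : Fin N => a ≤ v ∧ v < τ a ∧ ∀ p, a < p → τ p ≠ v) := by
    intro v
    simp only [mem_filter, mem_univ, true_and]
    exact fun ⟨h1, h2, h3⟩ => ⟨h1, h2.trans hlt, fun p hp => h p hp ▸ h3 p hp⟩
  refine card_lt_card ((ssubset_iff_of_subset hsub).2 ⟨σ a, ?_, by simp⟩)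
  simp only [mem_filter, mem_univ, true_and]
  exact ⟨ha, hlt, fun p hp heq => (ne_of_gt hp) (σ.injective ((h p hp).trans heq))⟩

/-- The code is injective (compare at the largest position of disagreement). [folklore] -/
theorem eq_of_code_eq {σ τ : Equiv.Perm (Fin N)} (hστ : code(σ) = code(τ)) : σ = τ := by
  by_contra hne
  have hex : (univ.filter fun p : Fin N => σ p ≠ τ p).Nonempty := by
    by_contra h0
    rw [not_nonempty_iff_eq_empty, filter_eq_empty_iff] at h0
    exact hne (Equiv.ext fun p => by simpa using h0 (mem_univ p))
  set a := (univ.filter fun p : Fin N => σ p ≠ τ p).max' hex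
  have ha : σ a ≠ τ a := by simpa using max'_mem _ hex
  have habove : ∀ p, a < p → σ p = τ p := fun p hp => by
    by_contra hp'
    exact absurd hp (not_lt.2 (le_max' _ p (by simpa using hp')))
  have hc := congr_fun hστ a
  by_cases hσ : a.val ≤ (σ a).val <;> by_cases hτ : a.val ≤ (τ a).val <;>
    simp only [hσ, hτ, if_true, if_false, Sum.inl.injEq, Sum.inr.injEq, reduceCtorEq] at hc
  · rcases lt_or_gt_of_ne ha with hlt | hgt
    · exact absurd hc (rank_lt_rank habove (Fin.le_def.2 hσ) hlt).ne
    · exact absurd hc.symm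
        (rank_lt_rank (fun p hp => (habove p hp).symm) (Fin.le_def.2 hτ) hgt).ne
  · exact ha (Fin.ext (by omega))

/-- On a weak excedance the rank is at most the number of drops jumping over it (cut identity:
as many positions below `a` map to `≥ a` as positions `≥ a` map below `a`). [folklore] -/
theorem rank_le (σ : Equiv.Perm (Fin N)) {a : Fin N} (ha : a ≤ σ a) :
    rk(σ, a) ≤ #(univ.filter fun p : Fin N => a < p ∧ σ p < a) := by
  set A : Finset (Fin N) := univ.filter fun p => p < a with hA
  set B : Finset (Fin N) := univ.filter fun p => σ p < a with hB
  have hBe : B = A.map σ.symm.toEmbedding := by ext p; simp [hA, hB, mem_map_equiv]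
  have e := ((card_sdiff_add_card_inter A B).trans (by rw [hBe, card_map])).trans
    (card_sdiff_add_card_inter B A).symm
  rw [inter_comm] at e
  have h1 : (univ.filter fun v : Fin N => a ≤ v ∧ v < σ a ∧ ∀ p, a < p → σ p ≠ v) ⊆
      (A \ B).image σ := by
    intro v
    simp only [hA, hB, mem_filter, mem_univ, true_and, mem_image, mem_sdiff, not_lt, and_imp]
    intro hav hv hp
    refine ⟨σ.symm v, ⟨?_, by simpa using hav⟩, by simp⟩
    by_contra hlt
    rcases (not_lt.1 hlt).lt_or_eq with hlt' | heq
    · exact hp _ hlt' (by simp)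
    · exact absurd hv (by rw [heq, Equiv.apply_symm_apply]; exact lt_irrefl _)
  have h2 : B \ A = univ.filter fun p : Fin N => a < p ∧ σ p < a := by
    ext p
    simp only [hA, hB, mem_sdiff, mem_filter, mem_univ, true_and, not_lt]
    refine ⟨fun ⟨h1, h2⟩ => ⟨lt_of_le_of_ne h2 ?_, h1⟩, fun ⟨h1, h2⟩ => ⟨h2, h1.le⟩⟩
    rintro rfl
    exact absurd h1 (not_lt.2 ha)
  calc rk(σ, a) ≤ #((A \ B).image σ) := card_le_card h1
    _ ≤ #(A \ B) := card_image_le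
    _ = #(B \ A) := by omega
    _ = _ := by rw [h2]

/-- The total rank over the weak excedances is at most the surplus. [folklore] -/
theorem sum_rank_le (σ : Equiv.Perm (Fin N)) :
    ∑ a ∈ univ.filter (fun a : Fin N => a.val ≤ (σ a).val), rk(σ, a) ≤ sur(σ) := by
  calc ∑ a ∈ univ.filter (fun a : Fin N => a.val ≤ (σ a).val), rk(σ, a)
      ≤ ∑ a ∈ univ.filter (fun a : Fin N => a.val ≤ (σ a).val),
          #(univ.filter fun p : Fin N => a < p ∧ σ p < a) :=
        sum_le_sum fun a ha => rank_le σ (Fin.le_def.2 (by simpa using ha))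
    _ ≤ ∑ a, #(univ.filter fun p : Fin N => a < p ∧ σ p < a) :=
        sum_le_sum_of_subset_of_nonneg (filter_subset _ _) fun _ _ _ => Nat.zero_le _
    _ = ∑ p, #(univ.filter fun a : Fin N => a < p ∧ σ p < a) :=
        sum_card_bipartiteAbove_eq_sum_card_bipartiteBelow (r := fun a p => a < p ∧ σ p < a)
    _ = ∑ p, (p.val - (σ p).val - 1) := by
        refine sum_congr rfl fun p _ => ?_
        rw [← Fin.card_Ioo]
        congr 1; ext a; simp [and_comm]

/-- Position `0` has rank `0`. [folklore] -/
theorem rank_zero [NeZero N] (σ : Equiv.Perm (Fin N)) : rk(σ, 0) = 0 := by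
  rw [card_eq_zero, filter_eq_empty_iff]
  intro v _
  push Not
  refine fun _ hv => ⟨σ.symm v, Fin.pos_iff_ne_zero.2 fun h0 => ?_, by simp⟩
  have : σ 0 = v := by rw [← h0]; simp
  exact absurd hv (by rw [this]; exact lt_irrefl _)

/-- Conservation (`∑ σ i = ∑ i`): excedance total `+ #W =` surplus `+ N`. [folklore] -/
theorem exc_add_card (σ : Equiv.Perm (Fin N)) :
    (∑ i, ((σ i).val - i.val)) + #(univ.filter fun i : Fin N => i.val ≤ (σ i).val) =
      sur(σ) + N := by
  have hsum : ∑ i, ((σ i).val + ((i.val - (σ i).val - 1) + 1)) =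
      ∑ i, (i.val + (((σ i).val - i.val) + if i.val ≤ (σ i).val then 1 else 0)) :=
    Fintype.sum_congr _ _ fun i => by split_ifs <;> omega
  simp only [sum_add_distrib, sum_boole, sum_const, card_univ, Fintype.card_fin, smul_eq_mul,
    mul_one, Nat.cast_id] at hsum
  have hσ : ∑ i, (σ i).val = ∑ i : Fin N, i.val := Equiv.sum_comp σ (fun i => i.val)
  omega

/-- If every nonzero position drops by exactly one then `σ 0 = last` (rotation). [folklore] -/
theorem apply_zero_eq_last {m : ℕ} (σ : Equiv.Perm (Fin (m + 1)))
    (h : ∀ a : Fin (m + 1), a ≠ 0 → code(σ) a = Sum.inl 0) : σ 0 = Fin.last m := by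
  have h' : ∀ a : Fin (m + 1), a ≠ 0 → (σ a).val + 1 = a.val := fun a ha => by
    have hc := h a ha
    dsimp only at hc
    split_ifs at hc with hle
    simp only [Sum.inl.injEq] at hc
    omega
  by_contra hne
  have hlt : (σ 0).val < m := Fin.val_lt_last hne
  set a : Fin (m + 1) := ⟨(σ 0).val + 1, by omega⟩ with ha_def
  have ha : a ≠ 0 := fun h0 => by simpa [ha_def] using congrArg Fin.val h0
  have h1 : (σ a).val + 1 = (σ 0).val + 1 := h' a ha
  exact ha (σ.injective (Fin.ext (by omega)))

variable {m : ℕ}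

/-- `(1 + x) ^ m ≤ 5 / 4` when `0 ≤ x` and `m x ≤ 1 / 5`. [folklore] -/
theorem one_add_pow_le {x : ℝ} (hx : 0 ≤ x) (hm : (m : ℝ) * x ≤ 1 / 5) :
    (1 + x) ^ m ≤ 5 / 4 := by
  have key : ∀ k : ℕ, k ≤ m → (1 + x) ^ k ≤ 1 + 5 / 4 * k * x := by
    intro k
    induction k with
    | zero => intro; simp
    | succ k ih =>
      intro hk
      have hkm : (k : ℝ) ≤ m := by exact_mod_cast Nat.le_of_succ_le hk
      have hkx : (k : ℝ) * x ≤ 1 / 5 := le_trans (mul_le_mul_of_nonneg_right hkm hx) hm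
      rw [pow_succ]
      push_cast
      nlinarith [mul_le_mul_of_nonneg_right (ih (Nat.le_of_succ_le hk))
        (by linarith : (0 : ℝ) ≤ 1 + x), mul_le_mul_of_nonneg_right hkx hx]
  nlinarith [key m le_rfl]

/-- `phi(Λ, δ, σ)`: the normalized weight `Λ (Λδ)^{sur σ} / Λ^{#W}`. -/
local notation3 (prettyPrint := false) "phi(" Λ ", " δ ", " σ ")" => (Λ * (Λ * δ) ^ sur(σ) /
  Λ ^ Finset.card (Finset.filter (fun i => Fin.val i ≤ Fin.val (σ i)) Finset.univ))

/-- Product of the weights `Λ ^ e * δ ^ (e + 1)` over `A`, given exponent identities. [folklore] -/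
theorem prod_weight_eq {Λ : ℝ} (hΛ : Λ ≠ 0) (δ : ℝ) (σ : Equiv.Perm (Fin (m + 1)))
    (A : Finset (Fin (m + 1))) (s k k' : ℕ) (h1 : ∑ i ∈ A, ((σ i).val - i.val) + #A = s + k)
    (h2 : ∑ i ∈ A, ((σ i).val - i.val) +
      #(univ.filter fun i : Fin (m + 1) => i.val ≤ (σ i).val) = s + k') :
    ∏ i ∈ A, (Λ ^ ((σ i).val - i.val) * δ ^ ((σ i).val - i.val + 1)) =
      Λ ^ (s + k') * δ ^ (s + k) / Λ ^ #(univ.filter fun i : Fin (m + 1) => i.val ≤ (σ i).val) := by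
  rw [eq_div_iff (pow_ne_zero _ hΛ), prod_mul_distrib, prod_pow_eq_pow_sum, prod_pow_eq_pow_sum,
    sum_add_distrib, sum_const, smul_eq_mul, mul_one, ← h1, ← h2]
  ring

/-- First summand `= y_m * Φ σ`. [folklore] -/
theorem summand_one_eq {Λ : ℝ} (hΛ : Λ ≠ 0) (δ : ℝ) (σ : Equiv.Perm (Fin (m + 1))) :
    ∏ i ∈ univ.filter (fun i : Fin (m + 1) => i.val ≤ (σ i).val),
        (Λ ^ ((σ i).val - i.val) * δ ^ ((σ i).val - i.val + 1)) =
      Λ ^ m * δ ^ (m + 1) * phi(Λ, δ, σ) := by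
  have hE := exc_add_card σ
  rw [← sum_filter_of_ne (s := univ) (p := fun i : Fin (m + 1) => i.val ≤ (σ i).val)
    (f := fun i => (σ i).val - i.val) (fun i _ h => by omega)] at hE
  rw [prod_weight_eq hΛ δ σ _ _ (m + 1) (m + 1) hE hE]
  ring

/-- Second summand `= Φ σ` when `σ 0 = last`. [folklore] -/
theorem summand_two_eq {Λ : ℝ} (hΛ : Λ ≠ 0) (δ : ℝ) (σ : Equiv.Perm (Fin (m + 1)))
    (h0 : σ 0 = Fin.last m) :
    ∏ i ∈ univ.filter (fun i : Fin (m + 1) => i ≠ 0 ∧ i.val ≤ (σ i).val),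
        (Λ ^ ((σ i).val - i.val) * δ ^ ((σ i).val - i.val + 1)) = phi(Λ, δ, σ) := by
  set W := univ.filter (fun i : Fin (m + 1) => i.val ≤ (σ i).val) with hW
  set W' := univ.filter (fun i : Fin (m + 1) => i ≠ 0 ∧ i.val ≤ (σ i).val) with hW'
  have hE := exc_add_card σ
  have h0W : (0 : Fin (m + 1)) ∈ W := by simp [hW]
  have hWW' : W.erase 0 = W' := by
    ext i; simp only [hW, hW', mem_erase, mem_filter, mem_univ, true_and]
  have hsumW : ∑ i, ((σ i).val - i.val) = m + ∑ i ∈ W', ((σ i).val - i.val) := by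
    rw [← sum_filter_of_ne (s := univ) (p := fun i : Fin (m + 1) => i.val ≤ (σ i).val)
      (fun i _ h => by omega), ← hW, ← add_sum_erase W _ h0W, hWW', h0]
    simp
  have hcard : #W = #W' + 1 := by rw [← hWW', card_erase_add_one h0W]
  rw [← hW, hsumW, hcard] at hE
  rw [prod_weight_eq hΛ δ σ W' sur(σ) 0 1 (by omega) (by rw [← hW]; omega), ← hW]
  ring

/-- `Φ σ ≤ Ω (code σ)` with `Ω c = Λ ∏ κ (c i)`, `κ = (q ^ ·) ⊕ (Λ⁻¹ 2^{-·})`, `q = 2 Λ δ`.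
[folklore] -/
theorem phi_le_omega {Λ δ : ℝ} (hΛ : 0 < Λ) (hδ : 0 ≤ δ) (σ : Equiv.Perm (Fin (m + 1))) :
    phi(Λ, δ, σ) ≤ Λ * ∏ i, Sum.elim (fun u : ℕ => (2 * Λ * δ) ^ u)
      (fun r : ℕ => Λ⁻¹ * (1 / 2 : ℝ) ^ r) (code(σ) i) := by
  have hR := sum_rank_le σ
  set W := univ.filter (fun i : Fin (m + 1) => i.val ≤ (σ i).val) with hW
  have hprod : ∏ i, Sum.elim (fun u : ℕ => (2 * Λ * δ) ^ u) (fun r : ℕ => Λ⁻¹ * (1 / 2 : ℝ) ^ r)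
      (code(σ) i) = (∏ i ∈ W, Λ⁻¹ * (1 / 2 : ℝ) ^ rk(σ, i)) *
        ∏ i ∈ univ.filter (fun i : Fin (m + 1) => ¬ i.val ≤ (σ i).val),
          (2 * Λ * δ) ^ (i.val - (σ i).val - 1) := by
    rw [← prod_ite]
    refine prod_congr rfl fun i _ => ?_
    dsimp only
    split_ifs <;> rfl
  have hsur : ∑ i ∈ univ.filter (fun i : Fin (m + 1) => ¬ i.val ≤ (σ i).val),
      (i.val - (σ i).val - 1) = sur(σ) := sum_filter_of_ne (fun i _ h => by omega)
  rw [hprod, prod_mul_distrib, prod_const, prod_pow_eq_pow_sum, prod_pow_eq_pow_sum, hsur]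
  have h2 : (1 / 2 : ℝ) ^ sur(σ) ≤ (1 / 2) ^ ∑ i ∈ W, rk(σ, i) :=
    pow_le_pow_of_le_one (by norm_num) (by norm_num) hR
  have hq' : Λ * δ = 1 / 2 * (2 * Λ * δ) := by ring
  calc Λ * (Λ * δ) ^ sur(σ) / Λ ^ #W
      = Λ * ((1 / 2) ^ sur(σ) * (2 * Λ * δ) ^ sur(σ)) / Λ ^ #W := by rw [hq', mul_pow]
    _ ≤ Λ * ((1 / 2) ^ (∑ i ∈ W, rk(σ, i)) * (2 * Λ * δ) ^ sur(σ)) / Λ ^ #W := by gcongr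
    _ = _ := by rw [inv_pow]; ring

/-- `box(m)`: the box of codes, `{inr 0}` at position `0` and `range (m+1) ⊕ range (m+2)` else. -/
local notation3 (prettyPrint := false) "box(" m ")" => (Fin.cons {Sum.inr 0}
  (fun _ : Fin m => (Finset.range (m + 1)).disjSum (Finset.range (m + 2))) :
    Fin (m + 1) → Finset (ℕ ⊕ ℕ))

/-- Every code lies in the box. [folklore] -/
theorem code_mem_box (σ : Equiv.Perm (Fin (m + 1))) : code(σ) ∈ Fintype.piFinset box(m) := by
  refine Fintype.mem_piFinset.2 fun a => Fin.cases ?_ (fun i => ?_) a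
  · rw [Fin.cons_zero, mem_singleton, if_pos (by simp), rank_zero σ]
  · rw [Fin.cons_succ]
    split_ifs
    · exact inr_mem_disjSum.2 (mem_range.2 (Nat.lt_succ_of_le ((card_le_univ _).trans (by simp))))
    · exact inl_mem_disjSum.2 (mem_range.2 (by omega))

/-- The total code weight over the box is at most `5 / 4`. [folklore] -/
theorem sum_box_le (n m : ℕ) (δ : ℝ) (hmn : m + 1 ≤ n) (hδ : 0 ≤ δ)
    (hδ' : δ ≤ 1 / (240 * (n : ℝ) ^ 3)) :
    ∑ c ∈ Fintype.piFinset box(m), (16 * (n : ℝ)) * ∏ i, Sum.elim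
      (fun u : ℕ => (2 * (16 * n) * δ) ^ u) (fun r : ℕ => (16 * (n : ℝ))⁻¹ * (1 / 2 : ℝ) ^ r) (c i)
      ≤ 5 / 4 := by
  set Λ : ℝ := 16 * n with hΛ
  set q : ℝ := 2 * Λ * δ with hq
  have hn1 : (1 : ℝ) ≤ n := by exact_mod_cast (by omega : 1 ≤ n)
  have hΛpos : 0 < Λ := by positivity
  have hq0 : 0 ≤ q := by positivity
  have hqn : q * (15 * (n : ℝ) ^ 2) ≤ 2 := by
    have : δ * (240 * (n : ℝ) ^ 3) ≤ 1 := (le_div_iff₀ (by positivity)).1 hδ'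
    rw [hq, hΛ]; nlinarith
  have hq1 : q * 15 ≤ 2 := by
    nlinarith [mul_le_mul_of_nonneg_left (by nlinarith : (1 : ℝ) ≤ n ^ 2) hq0]
  rw [← mul_sum, ← prod_univ_sum, Fin.prod_univ_succ]
  simp only [Fin.cons_zero, Fin.cons_succ, sum_singleton, Sum.elim_inr, pow_zero, mul_one,
    prod_const, card_univ, Fintype.card_fin]
  rw [← mul_assoc, mul_inv_cancel₀ hΛpos.ne', one_mul]
  -- one factor is at most `1 + x`, `x = 2 q + 2 / Λ`
  set S := ∑ j ∈ (range (m + 1)).disjSum (range (m + 2)),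
    Sum.elim (fun u : ℕ => q ^ u) (fun r : ℕ => Λ⁻¹ * (1 / 2 : ℝ) ^ r) j with hS_def
  have hS : S ≤ 1 + (2 * q + 2 / Λ) := by
    rw [hS_def, sum_disjSum]
    simp only [Sum.elim_inl, Sum.elim_inr]
    have h1 : ∑ u ∈ range (m + 1), q ^ u ≤ (1 - q)⁻¹ :=
      sum_le_hasSum _ (fun i _ => by positivity) (hasSum_geometric_of_lt_one hq0 (by linarith))
    have h2 : ∑ r ∈ range (m + 2), Λ⁻¹ * (1 / 2 : ℝ) ^ r ≤ Λ⁻¹ * 2 := by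
      rw [← mul_sum]
      exact mul_le_mul_of_nonneg_left (sum_geometric_two_le _) (by positivity)
    have h3 : (1 - q)⁻¹ ≤ 1 + 2 * q := by
      rw [inv_le_iff_one_le_mul₀ (by linarith)]; nlinarith
    calc _ ≤ (1 - q)⁻¹ + Λ⁻¹ * 2 := add_le_add h1 h2
      _ ≤ _ := by rw [inv_mul_eq_div]; linarith
  have hSnn : 0 ≤ S := sum_nonneg fun j _ => by rcases j with u | r <;> simp <;> positivity
  have hx : 0 ≤ 2 * q + 2 / Λ := by positivity
  -- `m x ≤ 1 / 15 + 1 / 8 ≤ 1 / 5`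
  have hm0 : (0 : ℝ) ≤ m := by positivity
  have hmR : (m : ℝ) ≤ n - 1 := by linarith [(by exact_mod_cast hmn : (m : ℝ) + 1 ≤ n)]
  have hmx : (m : ℝ) * (2 * q + 2 / Λ) ≤ 1 / 5 := by
    have ha : (m : ℝ) * q ≤ 1 / 30 := by
      nlinarith [mul_le_mul_of_nonneg_left hqn hm0, sq_nonneg ((n : ℝ) - 2),
        mul_le_mul_of_nonneg_left hmR (by positivity : (0 : ℝ) ≤ q * (15 * (n : ℝ) ^ 2))]
    have hb : (m : ℝ) * (2 / Λ) ≤ 1 / 8 := by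
      rw [mul_div_assoc', div_le_iff₀ hΛpos, hΛ]; linarith
    linarith
  calc S ^ m ≤ (1 + (2 * q + 2 / Λ)) ^ m := pow_le_pow_left₀ hSnn hS m
    _ ≤ 5 / 4 := one_add_pow_le hx hmx

/-- **Stub `stub_permCounts` (the two permutation counts of the arc induction).**  With
`Λ = 16 n`, `y_l = Λ ^ l δ ^ (l + 1)`, `1 ≤ m`, `m + 1 ≤ n`, `0 ≤ δ ≤ 1 / (240 n³)`:
the sum over the permutations `σ` of `Fin (m + 1)` with `σ 0 ≠ last` of `∏_{i ≤ σ i} y_{σ i - i}`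
is at most `y_m / 4`, and the sum over those with `σ 0 = last` of `∏_{i ≠ 0, i ≤ σ i} y_{σ i - i}`
is at most `3 / 2`. [folklore] -/
theorem stub_permCounts :
    ∀ (n m : ℕ) (δ : ℝ), 1 ≤ m → m + 1 ≤ n → 0 ≤ δ → δ ≤ 1 / (240 * (n : ℝ) ^ 3) →
      (∑ σ ∈ (Finset.univ : Finset (Equiv.Perm (Fin (m + 1)))).filter (fun σ => σ 0 ≠ Fin.last m),
          ∏ i ∈ (Finset.univ : Finset (Fin (m + 1))).filter (fun i => i.val ≤ (σ i).val),
            (16 * (n : ℝ)) ^ ((σ i).val - i.val) * δ ^ ((σ i).val - i.val + 1)) ≤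
          (16 * (n : ℝ)) ^ m * δ ^ (m + 1) / 4 ∧
      (∑ σ ∈ (Finset.univ : Finset (Equiv.Perm (Fin (m + 1)))).filter (fun σ => σ 0 = Fin.last m),
          ∏ i ∈ (Finset.univ : Finset (Fin (m + 1))).filter (fun i => i ≠ 0 ∧ i.val ≤ (σ i).val),
            (16 * (n : ℝ)) ^ ((σ i).val - i.val) * δ ^ ((σ i).val - i.val + 1)) ≤ 3 / 2 := by
  intro n m δ hm hmn hδ hδ'
  set Λ : ℝ := 16 * n with hΛ
  have hn2 : (2 : ℝ) ≤ n := by exact_mod_cast (by omega : 2 ≤ n)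
  have hΛpos : 0 < Λ := by positivity
  set Ω : (Fin (m + 1) → ℕ ⊕ ℕ) → ℝ := fun c => Λ * ∏ i, Sum.elim (fun u : ℕ => (2 * Λ * δ) ^ u)
    (fun r : ℕ => Λ⁻¹ * (1 / 2 : ℝ) ^ r) (c i) with hΩ
  have hΩ0 : ∀ c, 0 ≤ Ω c := fun c =>
    mul_nonneg hΛpos.le (prod_nonneg fun i _ => by rcases c i with u | r <;> simp <;> positivity)
  have hbox : ∑ c ∈ Fintype.piFinset box(m), Ω c ≤ 5 / 4 := sum_box_le n m δ hmn hδ hδ'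
  -- `∑_{σ ∈ F} Φ σ ≤ ∑_{c ∈ T} Ω c` whenever `code '' F ⊆ T`
  have hsum : ∀ (F : Finset (Equiv.Perm (Fin (m + 1)))) (T : Finset (Fin (m + 1) → ℕ ⊕ ℕ)),
      (∀ σ ∈ F, code(σ) ∈ T) → ∑ σ ∈ F, phi(Λ, δ, σ) ≤ ∑ c ∈ T, Ω c := fun F T hT =>
    calc ∑ σ ∈ F, phi(Λ, δ, σ) ≤ ∑ σ ∈ F, Ω code(σ) :=
          sum_le_sum fun σ _ => phi_le_omega hΛpos hδ σ
      _ = ∑ c ∈ F.image fun σ => code(σ), Ω c := by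
          rw [sum_image fun σ _ τ _ h => eq_of_code_eq h]
      _ ≤ ∑ c ∈ T, Ω c := sum_le_sum_of_subset_of_nonneg
          (fun c hc => by obtain ⟨σ, hσ, rfl⟩ := mem_image.1 hc; exact hT σ hσ) fun c _ _ => hΩ0 c
  -- the code of the rotation
  set crot : Fin (m + 1) → ℕ ⊕ ℕ := fun a => if a = 0 then Sum.inr 0 else Sum.inl 0 with hcrot
  have hcrot_mem : crot ∈ Fintype.piFinset box(m) := Fintype.mem_piFinset.2 fun a =>
    Fin.cases (by simp [hcrot]) (fun i => by simp [hcrot, Fin.succ_ne_zero]) a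
  have hΩrot : Ω crot = 1 := by
    simp only [hΩ, hcrot, Fin.prod_univ_succ]
    simp [Fin.succ_ne_zero, hΛpos.ne']
  refine ⟨?_, ?_⟩
  · have hy : 0 ≤ Λ ^ m * δ ^ (m + 1) := by positivity
    calc _ = ∑ σ ∈ (univ : Finset (Equiv.Perm (Fin (m + 1)))).filter
              (fun σ => σ 0 ≠ Fin.last m), Λ ^ m * δ ^ (m + 1) * phi(Λ, δ, σ) :=
          sum_congr rfl fun σ _ => summand_one_eq hΛpos.ne' δ σ
      _ ≤ Λ ^ m * δ ^ (m + 1) * ∑ c ∈ (Fintype.piFinset box(m)).erase crot, Ω c := by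
          rw [← mul_sum]
          refine mul_le_mul_of_nonneg_left (hsum _ _ fun σ hσ => mem_erase.2 ⟨fun heq => ?_,
            code_mem_box σ⟩) hy
          refine (mem_filter.1 hσ).2 (apply_zero_eq_last σ fun a ha => ?_)
          rw [heq]; simp [hcrot, ha]
      _ = Λ ^ m * δ ^ (m + 1) * (∑ c ∈ Fintype.piFinset box(m), Ω c - 1) := by
          rw [sum_erase_eq_sub hcrot_mem, hΩrot]
      _ ≤ Λ ^ m * δ ^ (m + 1) * (5 / 4 - 1) := by gcongr
      _ = _ := by ring
  · calc _ = ∑ σ ∈ (univ : Finset (Equiv.Perm (Fin (m + 1)))).filter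
              (fun σ => σ 0 = Fin.last m), phi(Λ, δ, σ) :=
          sum_congr rfl fun σ hσ => summand_two_eq hΛpos.ne' δ σ (by simpa using hσ)
      _ ≤ ∑ c ∈ Fintype.piFinset box(m), Ω c := hsum _ _ fun σ _ => code_mem_box σ
      _ ≤ 3 / 2 := hbox.trans (by norm_num)

end Summit.ValiantsHypothesis.ValiantsHypothesis.Theorems.PriceOfContractivity.PermCounts
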